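import Summits.HodgeConjecture.HodgeConjecture.Theorems.MarkmanPartnerTransportPartnerTransportEndomorphisms
import Summits.HodgeConjecture.HodgeConjecture.Theorems.MarkmanPartnerTransportPartnerTransportTranscendental
import Literature.AlgebraicGeometry.Surfaces.K3RealMultiplicationCycleInduced
import Literature.AlgebraicGeometry.Hyperkaehler.K3HilbertSquareIncidence

/-!
# Route MarkmanPartnerTransport · cruxes #4 `PicardThreeK3Squares` / #5 `LowPicardRealMultiplication` —
# «PARTNER-RM-TYPE»: the real-multiplication datum of `X` DESCENDS to a K3 partner `S`

Cell hodge-nonav, chapter ROUTE-P1AL (RM cells); planner p1 g40 ASSIGN «PARTNER-RM-TYPE» (2026-08-28T18:03Z);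
prover seat hodge-nonav-20241-p1 (gen 16). `--supports stmt-HodgeConjecture-19653` helper; no Theses import.

For the partner data of `exists_markedHodgeIsometry_of_partner` (marked `(X, φ, P, z)`, marked projective K3
`(S, η, p, x)`, the marked Hilbert square `(H, φ_H, P_H, (x,0))` with Beauville's algebraic incidence `θ`,
`φ_H([θ]_* a) = (η a, 0)`, and `g : H²(S) → H²(X)` with (g1), (g2), (g5)), the `X`-side RM datum
`RMgen[X, φ, z, d]` of «RM-GEN» (`…LowPicardRMCells`: a rational, type-preserving, `q`-self-adjoint `θ_X`
with REAL `σ`-eigenvalue of minimal-polynomial degree `d` such that every rational type-preserving endomorphism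
of `H²(X)` is a rational polynomial in `θ_X` of degree `< d` on `T(X)`) DESCENDS:

* **`exists_generator_natDegree_of_partner`** — there is a rational, type-preserving endomorphism
  `θ_S := π ∘ e⁻¹ ∘ θ_X ∘ e ∘ [θ]_*` of `H²(S)` (`e : H²(H) ⥲ H²(X)` the marked rational Hodge isometry, `π` the
  retraction) which GENERATES the transcendental Hodge endomorphisms of `S`
  (`TranscendentalEndomorphismsGeneratedBy S θ_S`) and acts on the `2`-form `η⁻¹ x` by the SAME real eigenvalue
  `ev`, `deg minpoly_ℚ ev = d`. Proof: an admissible `f_S` is conjugated to `f_X = e [θ]_* f_S π e⁻¹`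
  (rational, type-preserving — as in `hodgeEndomorphisms_scalar_of_partner`), the GEN clause of `RMgen` writes
  `f_X = Σ cₖ θ_Xᵏ` on `T(X)`, and `θ_Xᵏ (e [θ]_* t) = e [θ]_* (θ_Sᵏ t)` for `t ∈ T(S)` because `θ_X` preserves
  `T_q(X) = e [θ]_* T(S)` (`q`-self-adjointness + Lefschetz `(1,1)`; `exists_incidence_eq_of_bbfTransc`);
  `e ∘ [θ]_*` is injective;
* `exists_generator_natDegree_of_partner_of_facts` — the same with `H` supplied by
  `Beauville1983_hilbertSquare_markedIncidence`.

So along a partner `[E(S):ℚ] = [E(X):ℚ] = d` in the precise sense consumed by «K3-CELL-GEN»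
(`OneCycle.transcendentalEndomorphismsGeneratedBy_of_generatedBy_of_natDegree`, p653795) — the input of the
leaf `…LowPicardRMPartneredCells` (HC⁴(X) for every PARTNERED member of a cell from ONE cycle on the partner).
(`ρ(S) = ρ(X) − 1` is `finrank_algebraicClasses_succ_eq_of_partner`, `…PartnerPicardRank`.) No definition,
no sorry, no new named fact; CONDITIONAL only on the displayed hypothesis `Voisin2003_cupProduct_algebraicClasses`
(resp. Beauville's incidence fact). Nothing here proves either crux or HC.

References: E. Markman, Compos. Math. 160 (2024) §1.1 Thm. 1.1; A. Beauville, J. Differential Geom. 18 (1983)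
§6 Prop. 6, §9 Lemme 1; Yu. G. Zarhin, J. reine angew. Math. 341 (1983) Thm. 1.5.1; B. van Geemen, Michigan
Math. J. 56 (2008) Lemma 3.2; D. Huybrechts, *Lectures on K3 Surfaces*, Ch. 3 Lemma 3.1, Cor. 3.3.6.
-/

noncomputable section

set_option linter.dupNamespace false

open scoped Matrix
open Module CategoryTheory MonoidalCategory Polynomial
open Literature.AlgebraicTopology.SingularHomology Literature.Geometry.Kaehler
open Literature.AlgebraicGeometry Literature.AlgebraicGeometry.Motives Literature.AlgebraicGeometry.HodgeTheory
open Literature.AlgebraicGeometry.Hyperkaehler Literature.AlgebraicGeometry.Surfaces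
open Summit.HodgeConjecture.HodgeConjecture.Theorems.NikulinTwinTransport
open Summit.HodgeConjecture.HodgeConjecture.Theorems.MarkmanPartnerTransport.BBFPositivity

namespace Summit.HodgeConjecture.HodgeConjecture.Theorems.MarkmanPartnerTransport.PartnerLattice

/-- `MarkedK3Sq[X, φ, P, z]`: VERBATIM the `let MarkedK3Sq := …` binder of the route declarations of
MarkmanPartnerTransport (clauses (m1)–(m6)). Local notation only. -/
local notation3 (prettyPrint := false) "MarkedK3Sq[" X ", " φ ", " P ", " z "]" =>
  (((IsIntegralClass P ∧ ∀ Q : complexBetti X (2 * 4), IsIntegralClass Q → ∃ n : ℤ, Q = n • P) ∧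
    (∀ c : complexBetti X 2, IsIntegralClass c ↔ ∃ v : K3HilbertIndex → ℤ, φ c = fun i => (v i : ℂ)) ∧
    (∀ a : complexBetti X 2, cupPowTwo a 4 = ((3 : ℂ) * (k3HilbertForm 2 (φ a) (φ a)) ^ 2) • P) ∧
    (IsOfHodgeType 4 X 2 2 0 (LinearEquiv.symm φ z) ∧
      ∀ τ : complexBetti X 2, IsOfHodgeType 4 X 2 2 0 τ → ∃ t : ℂ, τ = t • LinearEquiv.symm φ z) ∧
    (∀ c : complexBetti X 2, IsOfHodgeType 4 X 2 1 1 c ↔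
      (k3HilbertForm 2 (φ c) z = 0 ∧ k3HilbertForm 2 (φ c) (star z) = 0)) ∧
    (k3HilbertForm 2 z z = 0 ∧ 0 < (k3HilbertForm 2 (star z) z).re)))

/-- `MarkedK3[S, η, p, x]`: the six K3 marking clauses, VERBATIM those of
`Beauville1983_hilbertSquare_markedIncidence`. Local notation only. [cite: Huybrechts2016K3, Ch. 1 Prop. 3.5] -/
local notation3 (prettyPrint := false) "MarkedK3[" S ", " η ", " p ", " x "]" =>
  (IsIntegralClass p ∧
    (∀ q : complexBetti S (2 * 2), IsIntegralClass q → ∃ n : ℤ, q = n • p) ∧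
    (∀ c : complexBetti S (2 * 1), IsIntegralClass c ↔ ∃ v : K3Index → ℤ, η c = fun i => (v i : ℂ)) ∧
    (∀ a b : complexBetti S (2 * 1),
        cupProduct (rfl : 2 * 1 + 2 * 1 = 2 * 2) a b = k3Form (η a) (η b) • p) ∧
    IsOfHodgeType 2 S (2 * 1) 2 0 (LinearEquiv.symm η x) ∧
    (∀ τ : complexBetti S (2 * 1), IsOfHodgeType 2 S (2 * 1) 2 0 τ → ∃ t : ℂ, τ = t • LinearEquiv.symm η x))

/-- `RMgen[X, φ, z, d]` (VERBATIM `…LowPicardRMCells`): an RM generator `θ` of `E(X)` with `σ`-eigenvalue of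
degree `d`, the cell arithmetic `d·n + ρ(X) = 23` (`n ≥ 3`), and the GEN clause. Local notation only. -/
local notation3 (prettyPrint := false) "RMgen[" X ", " φ ", " z ", " d "]" =>
  (∃ θ : complexBetti X 2 →ₗ[ℂ] complexBetti X 2, (∀ y, IsRationalClass y → IsRationalClass (θ y)) ∧
    (∀ (i j : ℕ) y, IsOfHodgeType 4 X 2 i j y → IsOfHodgeType 4 X 2 i j (θ y)) ∧
    (∀ y w : complexBetti X 2, k3HilbertForm 2 (φ (θ y)) (φ w) = k3HilbertForm 2 (φ y) (φ (θ w))) ∧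
    ∃ ev : ℂ, θ (LinearEquiv.symm φ z) = ev • LinearEquiv.symm φ z ∧ ev.im = 0 ∧
      (minpoly ℚ ev).natDegree = d ∧
      (∃ n : ℕ, 3 ≤ n ∧ d * n + Module.finrank ℂ ↥(algebraicClasses X 1) = 23) ∧
      ∀ f : complexBetti X 2 →ₗ[ℂ] complexBetti X 2, (∀ y, IsRationalClass y → IsRationalClass (f y)) →
        (∀ (i j : ℕ) y, IsOfHodgeType 4 X 2 i j y → IsOfHodgeType 4 X 2 i j (f y)) →
        ∃ c : Fin d → ℚ, ∀ y : complexBetti X 2,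
          (∀ a : complexBetti X 2, a ∈ algebraicClasses X 1 → k3HilbertForm 2 (φ y) (φ a) = 0) →
            f y = ∑ i : Fin d, ((c i : ℂ) • (θ ^ (i : ℕ)) y))

/-- `K3Gen[S, η, x, d]`: the descended datum — a rational, type-preserving endomorphism `θ_S` of `H²(S(ℂ); ℂ)`
GENERATING the transcendental Hodge endomorphisms (`TranscendentalEndomorphismsGeneratedBy S θ_S`) whose
eigenvalue on the `2`-form `η⁻¹ x` is real with minimal polynomial of degree `d` (the `θ`-input of «K3-CELL-GEN»,
`OneCycle.transcendentalEndomorphismsGeneratedBy_of_generatedBy_of_natDegree`). Local notation only. -/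
local notation3 (prettyPrint := false) "K3Gen[" S ", " η ", " x ", " d "]" =>
  (∃ θS : complexBetti S (2 * 1) →ₗ[ℂ] complexBetti S (2 * 1),
    (∀ y, IsRationalClass y → IsRationalClass (θS y)) ∧
    (∀ (i j : ℕ) y, IsOfHodgeType 2 S (2 * 1) i j y → IsOfHodgeType 2 S (2 * 1) i j (θS y)) ∧
    TranscendentalEndomorphismsGeneratedBy S θS ∧
    ∃ ev : ℂ, θS (LinearEquiv.symm η x) = ev • LinearEquiv.symm η x ∧ ev.im = 0 ∧ (minpoly ℚ ev).natDegree = d)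

variable {X S H : SchemeOver ℂ} {φ : complexBetti X 2 ≃ₗ[ℂ] (K3HilbertIndex → ℂ)} {P : complexBetti X (2 * 4)}
  {z : K3HilbertIndex → ℂ} {η : complexBetti S (2 * 1) ≃ₗ[ℂ] (K3Index → ℂ)} {p : complexBetti S (2 * 2)}
  {x : K3Index → ℂ} {φH : complexBetti H 2 ≃ₗ[ℂ] (K3HilbertIndex → ℂ)} {PH : complexBetti H (2 * 4)}

/-- **«PARTNER-RM-TYPE»: the RM datum of `X` descends to the K3 partner `S`** (module docstring). Along the
partner data (marked `X`, marked projective K3 `S`, marked Hilbert square `H` with algebraic incidence, `g` with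
(g1), (g2), (g5)), `RMgen[X, φ, z, d]` yields a rational, type-preserving endomorphism `θ_S` of `H²(S)`
GENERATING `End_Hdg(T(S))` with the same real `(2,0)`-eigenvalue, of degree `d`: `K3Gen[S, η, x, d]`.
[cite: Markman2024, §1.1 Thm. 1.1] [cite: Beauville1983, §6 Prop. 6 and §9 Lemme 1]
[cite: Zarhin1983HodgeGroupsK3, Thm. 1.5.1] [cite: Vangeemen2008, Lemma 3.2] -/
theorem exists_generator_natDegree_of_partner
    (hcup : Voisin2003_cupProduct_algebraicClasses) {μ : OrientationFamily} (hμ : μ.HasPoincareDuality)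
    (hX : IsSmoothProjective 4 X) (hM : MarkedK3Sq[X, φ, P, z]) (hS : IsK3Surface S) (hp0 : p ≠ 0)
    (hηint : ∀ c : complexBetti S (2 * 1), IsIntegralClass c ↔ ∃ v : K3Index → ℤ, η c = fun i => (v i : ℂ))
    (hcupS : ∀ a b : complexBetti S (2 * 1),
      cupProduct (rfl : 2 * 1 + 2 * 1 = 2 * 2) a b = k3Form (η a) (η b) • p)
    (h20 : IsOfHodgeType 2 S (2 * 1) 2 0 (η.symm x))
    (h20span : ∀ τ : complexBetti S (2 * 1), IsOfHodgeType 2 S (2 * 1) 2 0 τ → ∃ t : ℂ, τ = t • η.symm x)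
    (hxpos : 0 < (k3Form (star x) x).re)
    (hH : IsSmoothProjective 4 H) (hMH : MarkedK3Sq[H, φH, PH, Sum.elim x 0])
    {θ : complexBetti (H ⊗ S) (2 * 2)} (hθ : θ ∈ algebraicClasses (H ⊗ S) 2)
    (hi : ∀ a : complexBetti S (2 * 1),
      φH (corrAction μ hH (IsK3Surface.isSmoothProjective hS) (rfl : 2 * 1 + 2 * 2 = 2 + 2 * 2) θ a) =
        Sum.elim (η a) 0)
    {g : complexBetti S (2 * 1) →ₗ[ℂ] complexBetti X 2}
    (hg1 : ∀ a, IsRationalClass a → IsRationalClass (g a))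
    (hg2 : ∀ (i j : ℕ) a, IsOfHodgeType 2 S (2 * 1) i j a → IsOfHodgeType 4 X 2 i j (g a))
    (hg5 : ∀ a b, (∀ d ∈ algebraicClasses S 1, cupProduct (rfl : 2 * 1 + 2 * 1 = 2 * 2) a d = 0) →
      (∀ d ∈ algebraicClasses S 1, cupProduct (rfl : 2 * 1 + 2 * 1 = 2 * 2) b d = 0) →
      k3HilbertForm 2 (φ (g a)) (φ (g b)) = k3Form (η a) (η b))
    {d : ℕ} (hR : RMgen[X, φ, z, d]) :
    K3Gen[S, η, x, d] := by
  classical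
  obtain ⟨-, hint, -, ⟨hz20, hz20span⟩, -⟩ := id hM
  obtain ⟨-, hintH, -⟩ := id hMH
  have hS2 : IsSmoothProjective 2 S := IsK3Surface.isSmoothProjective hS
  obtain ⟨θX, hθrat, hθtyp, hθsa, ev, hθev, hevreal, hdeg, -, hGEN⟩ := hR
  -- the marked rational Hodge isometry `e : H²(H) ⥲ H²(X)` and its inverse
  obtain ⟨f, hfbij, hfrat, hfh, hfq⟩ := exists_markedHodgeIsometry_of_partner hcup hμ hX hM hS hηint hcupS
    h20 hxpos hH hMH hθ hi hg1 hg2 hg5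
  obtain ⟨e, he, herat, heh, hseq⟩ := exists_inverse_markedHodgeIsometry hH hX hMH hM hfbij hfrat hfh hfq
  have herat' : ∀ c, IsRationalClass c → IsRationalClass (e c) := fun c hc => by rw [he]; exact hfrat c hc
  have heh' : ∀ (i j : ℕ) c, IsOfHodgeType 4 H 2 i j c → IsOfHodgeType 4 X 2 i j (e c) :=
    fun i j c hc => by rw [he]; exact hfh i j c hc
  have heq : ∀ a b, k3HilbertForm 2 (φ (e a)) (φ (e b)) = k3HilbertForm 2 (φH a) (φH b) :=
    fun a b => by rw [he, he]; exact hfq a b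
  -- `e⁻¹(N¹(X)) ⊆ N¹(H)`
  have hsymmN : ∀ d ∈ algebraicClasses X 1, e.symm d ∈ algebraicClasses H 1 := fun d hd =>
    map_mem_algebraicClasses_of_isRationalClass_of_oneOne hX hH (e.symm : complexBetti X 2 →ₗ[ℂ] complexBetti H 2)
      herat (heh 1 1) hd
  -- `i` and `π`
  set i : complexBetti S (2 * 1) →ₗ[ℂ] complexBetti H 2 :=
    corrAction μ hH hS2 (rfl : 2 * 1 + 2 * 2 = 2 + 2 * 2) θ with hidef
  have hi' : ∀ a, φH (i a) = Sum.elim (η a) 0 := hi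
  set π : complexBetti H 2 →ₗ[ℂ] complexBetti S (2 * 1) :=
    (η.symm : (K3Index → ℂ) →ₗ[ℂ] complexBetti S (2 * 1)) ∘ₗ
      LinearMap.funLeft ℂ ℂ (Sum.inl : K3Index → K3HilbertIndex) ∘ₗ
      (φH : complexBetti H 2 →ₗ[ℂ] (K3HilbertIndex → ℂ)) with hπdef
  have hπ : ∀ w, π w = η.symm (fun k => φH w (Sum.inl k)) := fun w => rfl
  -- `e ∘ i` carries cup-transcendental classes to `q`-transcendental classes
  have heiT : ∀ t : complexBetti S (2 * 1),
      (∀ d ∈ algebraicClasses S 1, cupProduct (rfl : 2 * 1 + 2 * 1 = 2 * 2) t d = 0) →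
      ∀ d : complexBetti X 2, d ∈ algebraicClasses X 1 → k3HilbertForm 2 (φ (e (i t))) (φ d) = 0 := by
    intro t htt d hd
    have h1 : k3HilbertForm 2 (φ (e (i t))) (φ d) = k3HilbertForm 2 (φ (e (i t))) (φ (e (e.symm d))) := by
      rw [LinearEquiv.apply_symm_apply]
    rw [h1, heq]
    exact incidence_bbfTransc hS hp0 hηint hcupS h20 hxpos hH hMH hi' htt _ (hsymmN d hd)
  -- `θ_X` preserves `q`-transcendental classes (self-adjoint, `N¹(X)`-stable by Lefschetz `(1,1)`)
  have hθXN : ∀ d ∈ algebraicClasses X 1, θX d ∈ algebraicClasses X 1 := fun d hd =>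
    map_mem_algebraicClasses_of_isRationalClass_of_oneOne hX hX θX hθrat (hθtyp 1 1) hd
  have hθXT : ∀ y : complexBetti X 2, (∀ d ∈ algebraicClasses X 1, k3HilbertForm 2 (φ y) (φ d) = 0) →
      ∀ d ∈ algebraicClasses X 1, k3HilbertForm 2 (φ (θX y)) (φ d) = 0 := fun y hy d hd => by
    rw [hθsa]; exact hy _ (hθXN d hd)
  -- `e⁻¹` carries `q`-transcendental classes of `X` to `q`-transcendental classes of `H`
  have hsymmT : ∀ y : complexBetti X 2, (∀ d ∈ algebraicClasses X 1, k3HilbertForm 2 (φ y) (φ d) = 0) →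
      ∀ d ∈ algebraicClasses H 1, k3HilbertForm 2 (φH (e.symm y)) (φH d) = 0 := fun y hy =>
    bbfTransc_map_of_markedHodgeIsometry hX hH e.symm
      (fun c hc => by rw [LinearEquiv.symm_symm]; exact herat' c hc)
      (fun c hc => by rw [LinearEquiv.symm_symm]; exact heh' 1 1 c hc) hseq hy
  -- the descended endomorphism `θ_S = π ∘ e⁻¹ ∘ θ_X ∘ e ∘ i`
  set θS : complexBetti S (2 * 1) →ₗ[ℂ] complexBetti S (2 * 1) :=
    π ∘ₗ (e.symm : complexBetti X 2 →ₗ[ℂ] complexBetti H 2) ∘ₗ θX ∘ₗ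
      (e : complexBetti H 2 →ₗ[ℂ] complexBetti X 2) ∘ₗ i with hθSdef
  have hθS : ∀ c, θS c = π (e.symm (θX (e (i c)))) := fun c => rfl
  -- rational
  have h1 : ∀ c, IsRationalClass c → IsRationalClass (θS c) := by
    intro c hc
    rw [hθS, hπ]
    exact isRationalClass_retraction hS hH hηint hintH
      (herat _ (hθrat _ (herat' _ (isRationalClass_incidence hS hH hηint hintH hi' hc))))
  -- Hodge types `(2,0)` and `(1,1)` through the chain, `(0,2)` by conjugation
  have h20S : ∀ c, IsOfHodgeType 2 S (2 * 1) 2 0 c → IsOfHodgeType 2 S (2 * 1) 2 0 (θS c) := by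
    intro c hc
    rw [hθS, hπ]
    exact retraction_twoZero hMH h20
      (heh 2 0 _ (hθtyp 2 0 _ (heh' 2 0 _ (incidence_twoZero hMH h20span hi' hc))))
  have h11S : ∀ c, IsOfHodgeType 2 S (2 * 1) 1 1 c → IsOfHodgeType 2 S (2 * 1) 1 1 (θS c) := by
    intro c hc
    rw [hθS, hπ]
    exact retraction_oneOne hS hp0 hηint hcupS h20 hxpos hMH
      (heh 1 1 _ (hθtyp 1 1 _ (heh' 1 1 _ (incidence_oneOne hS hp0 hηint hcupS h20 hxpos hMH hi' hc))))
  have hconj : ∀ c, θS (conjClass (ComplexPoints S) (2 * 1) c) = conjClass (ComplexPoints S) (2 * 1) (θS c) :=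
    fun c => (conjClass_apply_of_isRationalClass η hηint θS h1 c).symm
  have h2 : ∀ (a b : ℕ) c, IsOfHodgeType 2 S (2 * 1) a b c → IsOfHodgeType 2 S (2 * 1) a b (θS c) := by
    intro a b c hc
    by_cases hab : a + b = 2 * 1
    · have ha2 : a ≤ 2 := by omega
      interval_cases a
      · have hb : b = 2 := by omega
        subst hb
        rw [← conjClass_conjClass (θS c), ← hconj]
        exact (h20S _ (hc.conjClass hS2)).conjClass hS2
      · have hb : b = 1 := by omega
        subst hb
        exact h11S c hc
      · have hb : b = 0 := by omega
        subst hb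
        exact h20S c hc
    · have hc0 : c = 0 := by
        obtain ⟨A, hA⟩ := hc
        rw [(A.hodgePQ_eq_bot_iff (2 * 1) a b).2
            (Literature.NumberTheory.Transcendental.hodgePQ_eq_bot_of_ne (M := A.carrier) hab),
          Submodule.mem_bot] at hA
        exact A.pullback_injective (2 * 1) (by rw [hA, map_zero])
      rw [hc0, map_zero]
      exact isOfHodgeType_zero_of_isSmoothProjective nonempty_hodgeModel_holds hS2 (2 * 1) a b
  -- the eigenvalue on the `2`-form: `e (i (η⁻¹ x))` spans `H^{2,0}(X)`
  have heiσ20 : IsOfHodgeType 4 X 2 2 0 (e (i (η.symm x))) := heh' 2 0 _ (incidence_twoZero hMH h20span hi' h20)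
  have hev : θS (η.symm x) = ev • η.symm x := by
    obtain ⟨c, hc⟩ := hz20span _ heiσ20
    have h1' : θX (e (i (η.symm x))) = ev • e (i (η.symm x)) := by
      rw [hc, map_smul, hθev, smul_comm]
    rw [hθS, h1', map_smul, LinearEquiv.symm_apply_apply, map_smul, hπ, retraction_incidence hi']
  -- `θ_Xᵏ (e [θ]_* t) = e [θ]_* (θ_Sᵏ t)` on `T(S)`, and `θ_Sᵏ t ∈ T(S)`
  have hstep : ∀ t : complexBetti S (2 * 1), (∀ d ∈ algebraicClasses S 1,
      cupProduct (rfl : 2 * 1 + 2 * 1 = 2 * 2) t d = 0) →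
      θX (e (i t)) = e (i (θS t)) ∧
        ∀ d ∈ algebraicClasses S 1, cupProduct (rfl : 2 * 1 + 2 * 1 = 2 * 2) (θS t) d = 0 := by
    intro t htt
    have hw : ∀ d ∈ algebraicClasses H 1, k3HilbertForm 2 (φH (e.symm (θX (e (i t))))) (φH d) = 0 :=
      hsymmT _ (hθXT _ (heiT t htt))
    obtain ⟨hπwT, hiπw⟩ := exists_incidence_eq_of_bbfTransc hcup hμ hS hcupS hH hMH hθ hi hw
    rw [← hidef, ← hπ] at hiπw
    rw [← hπ] at hπwT
    refine ⟨?_, by rw [hθS]; exact hπwT⟩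
    rw [hθS, hiπw, LinearEquiv.apply_symm_apply]
  have hpow : ∀ (k : ℕ) (t : complexBetti S (2 * 1)), (∀ d ∈ algebraicClasses S 1,
      cupProduct (rfl : 2 * 1 + 2 * 1 = 2 * 2) t d = 0) →
      (θX ^ k) (e (i t)) = e (i ((θS ^ k) t)) ∧
        ∀ d ∈ algebraicClasses S 1, cupProduct (rfl : 2 * 1 + 2 * 1 = 2 * 2) ((θS ^ k) t) d = 0 := by
    intro k
    induction k with
    | zero => intro t htt; exact ⟨by rw [pow_zero, pow_zero, Module.End.one_apply, Module.End.one_apply], by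
        rw [pow_zero, Module.End.one_apply]; exact htt⟩
    | succ k ih =>
      intro t htt
      obtain ⟨hk1, hk2⟩ := ih t htt
      obtain ⟨hs1, hs2⟩ := hstep _ hk2
      refine ⟨?_, ?_⟩
      · rw [pow_succ', Module.End.mul_apply, hk1, hs1, pow_succ', Module.End.mul_apply]
      · rw [pow_succ', Module.End.mul_apply]; exact hs2
  -- GEN descends
  have hgen : TranscendentalEndomorphismsGeneratedBy S θS := by
    intro fS hr hh hk ht
    -- the conjugated endomorphism `fX = e ∘ i ∘ fS ∘ π ∘ e⁻¹` is rational and type-preserving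
    set fX : complexBetti X 2 →ₗ[ℂ] complexBetti X 2 :=
      (e : complexBetti H 2 →ₗ[ℂ] complexBetti X 2) ∘ₗ i ∘ₗ fS ∘ₗ π ∘ₗ
        (e.symm : complexBetti X 2 →ₗ[ℂ] complexBetti H 2) with hfXdef
    have hfX : ∀ c, fX c = e (i (fS (π (e.symm c)))) := fun c => rfl
    have hX1 : ∀ c, IsRationalClass c → IsRationalClass (fX c) := by
      intro c hc
      rw [hfX]
      refine herat' _ (isRationalClass_incidence hS hH hηint hintH hi' (hr _ ?_))
      rw [hπ]
      exact isRationalClass_retraction hS hH hηint hintH (herat c hc)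
    have h20X : ∀ c, IsOfHodgeType 4 X 2 2 0 c → IsOfHodgeType 4 X 2 2 0 (fX c) := by
      intro c hc
      rw [hfX]
      refine heh' 2 0 _ (incidence_twoZero hMH h20span hi' (hh 2 0 _ ?_))
      rw [hπ]
      exact retraction_twoZero hMH h20 (heh 2 0 c hc)
    have h11X : ∀ c, IsOfHodgeType 4 X 2 1 1 c → IsOfHodgeType 4 X 2 1 1 (fX c) := by
      intro c hc
      rw [hfX]
      refine heh' 1 1 _ (incidence_oneOne hS hp0 hηint hcupS h20 hxpos hMH hi' (hh 1 1 _ ?_))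
      rw [hπ]
      exact retraction_oneOne hS hp0 hηint hcupS h20 hxpos hMH (heh 1 1 c hc)
    have hfXconj : ∀ c, fX (conjClass (ComplexPoints X) 2 c) = conjClass (ComplexPoints X) 2 (fX c) :=
      conjClass_map_of_isRationalClass hX hX hint hint fX hX1
    have hX2 : ∀ (a b : ℕ) c, IsOfHodgeType 4 X 2 a b c → IsOfHodgeType 4 X 2 a b (fX c) := by
      intro a b c hc
      by_cases hab : a + b = 2
      · have ha2 : a ≤ 2 := by omega
        interval_cases a
        · have hb : b = 2 := by omega
          subst hb
          rw [← conjClass_conjClass (fX c), ← hfXconj]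
          exact (h20X _ (hc.conjClass hX)).conjClass hX
        · have hb : b = 1 := by omega
          subst hb
          exact h11X c hc
        · have hb : b = 0 := by omega
          subst hb
          exact h20X c hc
      · have hc0 : c = 0 := by
          obtain ⟨A, hA⟩ := hc
          rw [(A.hodgePQ_eq_bot_iff 2 a b).2
              (Literature.NumberTheory.Transcendental.hodgePQ_eq_bot_of_ne (M := A.carrier) hab),
            Submodule.mem_bot] at hA
          exact A.pullback_injective 2 (by rw [hA, map_zero])
        rw [hc0, map_zero]
        exact isOfHodgeType_zero_of_isSmoothProjective nonempty_hodgeModel_holds hX 2 a b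
    -- GEN on `X`, read back on `T(S)` through the injective `e ∘ i`
    obtain ⟨c, hc⟩ := hGEN fX hX1 hX2
    refine ⟨d, c, fun t htt => ?_⟩
    have hy := hc (e (i t)) (heiT t htt)
    rw [hfX, LinearEquiv.symm_apply_apply, hπ, retraction_incidence hi' t] at hy
    have hsum : (∑ k : Fin d, (c k : ℂ) • (θX ^ (k : ℕ)) (e (i t))) =
        e (i (∑ k : Fin d, (c k : ℂ) • (θS ^ (k : ℕ)) t)) := by
      rw [map_sum, map_sum]
      refine Finset.sum_congr rfl fun k _ => ?_
      rw [map_smul, map_smul, (hpow k t htt).1]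
    rw [hsum] at hy
    exact incidence_injective hi' (e.injective hy)
  exact ⟨θS, h1, h2, hgen, ev, hev, hevreal, hdeg⟩

/-- **«PARTNER-RM-TYPE» from Beauville's marked incidence** — the RM datum descends along every K3 partner
`(S, η, p, x, g)` of the route's `IsK3Partner` shape ((g1), (g2), (g5) used), the marked Hilbert square being
supplied by `Beauville1983_hilbertSquare_markedIncidence`. [cite: Beauville1983, §6 Prop. 6 and Remarque]
[cite: Markman2024, §1.1 Thm. 1.1] [cite: Zarhin1983HodgeGroupsK3, Thm. 1.5.1] -/
theorem exists_generator_natDegree_of_partner_of_facts (hBI : Beauville1983_hilbertSquare_markedIncidence)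
    (hcup : Voisin2003_cupProduct_algebraicClasses)
    (hX : IsSmoothProjective 4 X) (hM : MarkedK3Sq[X, φ, P, z]) (hS : IsK3Surface S) (hp0 : p ≠ 0)
    (hmk : MarkedK3[S, η, p, x]) (hx0 : k3Form x x = 0) (hxpos : 0 < (k3Form (star x) x).re)
    (hproj : ∃ u : K3Index → ℤ, k3Form (fun i => (u i : ℂ)) x = 0 ∧ 0 < ∑ i, ∑ j, u i * k3Gram i j * u j)
    {g : complexBetti S (2 * 1) →ₗ[ℂ] complexBetti X 2}
    (hg1 : ∀ a, IsRationalClass a → IsRationalClass (g a))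
    (hg2 : ∀ (i j : ℕ) a, IsOfHodgeType 2 S (2 * 1) i j a → IsOfHodgeType 4 X 2 i j (g a))
    (hg5 : ∀ a b, (∀ d ∈ algebraicClasses S 1, cupProduct (rfl : 2 * 1 + 2 * 1 = 2 * 2) a d = 0) →
      (∀ d ∈ algebraicClasses S 1, cupProduct (rfl : 2 * 1 + 2 * 1 = 2 * 2) b d = 0) →
      k3HilbertForm 2 (φ (g a)) (φ (g b)) = k3Form (η a) (η b))
    {d : ℕ} (hR : RMgen[X, φ, z, d]) :
    K3Gen[S, η, x, d] := by
  obtain ⟨H, hH, Ξ, φH, PH, -, -, hMH, θ, hθ, hi⟩ :=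
    hBI complexOrientationFamily hasPoincareDuality_complexOrientationFamily S hS η p x hmk hx0 hxpos hproj
  obtain ⟨-, -, hηint, hcupS, h20, h20span⟩ := hmk
  exact exists_generator_natDegree_of_partner hcup hasPoincareDuality_complexOrientationFamily hX hM hS hp0 hηint
    hcupS h20 h20span hxpos hH hMH hθ hi hg1 hg2 hg5 hR

end Summit.HodgeConjecture.HodgeConjecture.Theorems.MarkmanPartnerTransport.PartnerLattice

end
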